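import Literature.MathematicalPhysics.QuantumLattice.HubbardTorusMarkovPressureBound
import Literature.MathematicalPhysics.QuantumLattice.TorusSectorGibbsEnergyWindow
import Literature.MathematicalPhysics.QuantumLattice.SectorPartitionFnGrandCanonicalBound
import HarnessLib

/-!
# From a Markov pressure certificate at `β_h` to a certified upper edge of the thermal energy window

Topic `MathematicalPhysics/QuantumLattice`, namespace `Literature.MathematicalPhysics.QuantumLattice`.

The free-energy route to a certified THERMAL ENERGY WINDOW for the `t–t'` Hubbard model at density `n`
and inverse temperature `β` (`TorusSectorGibbsEnergyWindow.lean`: the hot chord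
`e_Φ(ω) ≤ (u_h − ℓ)/(β − β_h)` for every torus limit `ω` of the canonical sector Gibbs states at `β`,
from per-volume bounds `ℓ L² ≤ log Z_β^{sector}(L)` and `log Z_{β_h}^{sector}(L) ≤ u_h L²` eventually)
needs a certified UPPER bound on the canonical pressure at a hotter `β_h < β`. This file supplies it from
the finite-volume Markov certificate of `HubbardTorusMarkovPressureBound.lean`
(`hubbardTTPrime_log_partitionFn_le_of_certificate`: `log Z_{β_h}(H_L − μN_L) ≤ L² c + O(L)`) and the
grand-canonical comparison `log Z^{sector} ≤ log Z(H − μN) − βμ N_{sector}`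
(`log_partitionFn_sectorHamiltonianTT'_le_grandCanonical`):

* `exists_abs_re_trace_mul_density_le` — expectations of a fixed observable in density matrices are
  uniformly bounded (by its C⋆-norm), so the boundary term is `O(L)`;
* `eventually_log_partitionFn_sectorHamiltonianTT'_le_of_certificate` — for every `ε > 0`, eventually
  along `Ls → ∞`: `log Z_{β_h}^{sector}(Ls j) ≤ (c − β_h μ n + ε) (Ls j)²`;
* `IsTorusLimitOfMixture.meanEnergy_hubbardTTPrime_le_of_markov_certificate` — hence, for every torus
  limit `ω` of the sector Gibbs states at `β > β_h` with a cold free-energy input `ℓ`: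
  `e_Φ(ω) ≤ (c − β_h μ n − ℓ) / (β − β_h)`.

This is the assembly "E1–E2 + C1" of the `hubbard-thermal` free-energy programme in kernel form (Poulin–
Hastings Markov bound as the hot anchor of a convexity chord, [cite: PoulinHastings2011, eqs. (3)–(8)];
chords: Gibbs variational principle / convexity of `log Z`). Everything is PROVED; no definition, no
named fact.
-/

noncomputable section

namespace Literature.MathematicalPhysics.QuantumLattice

open Matrix Finset HubbardWave0 Literature.Probability.LatticeModels ThermodynamicLimit
open _root_.Filter
open scoped _root_.Topology ComplexOrder MatrixOrder
open Literature.InformationTheory.Entropy (vonNeumannEntropy)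

/-! ### §1. A uniform bound on expectations in density matrices -/

/-- **Expectations of a fixed Hermitian observable in density matrices are uniformly bounded**:
`|Re tr(σ h)| ≤ E` for all `σ ⪰ 0`, `tr σ = 1` (with `E` the operator norm of `h`:
`−‖h‖ ≤ h ≤ ‖h‖` in the Löwner order). [cite: Petz2008, §11.2] -/
theorem exists_abs_re_trace_mul_density_le {k : Type*} [Fintype k] [DecidableEq k] {h : Matrix k k ℂ}
    (hh : h.IsHermitian) :
    ∃ E : ℝ, ∀ σ : Matrix k k ℂ, σ.PosSemidef → σ.trace = 1 → |(σ * h).trace.re| ≤ E := by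
  open scoped Matrix.Norms.L2Operator in
  exact by
    letI : CStarAlgebra (Matrix k k ℂ) := {}
    refine ⟨‖h‖, fun σ hσ htr => ?_⟩
    have h1 : h ≤ algebraMap ℝ (Matrix k k ℂ) ‖h‖ := IsSelfAdjoint.le_algebraMap_norm_self hh.isSelfAdjoint
    have h2 : -(algebraMap ℝ (Matrix k k ℂ) ‖h‖) ≤ h := IsSelfAdjoint.neg_algebraMap_norm_le_self hh.isSelfAdjoint
    have halg : algebraMap ℝ (Matrix k k ℂ) ‖h‖ = ((‖h‖ : ℝ) : ℂ) • (1 : Matrix k k ℂ) := by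
      rw [Algebra.algebraMap_eq_smul_one]
      ext i j
      simp [Matrix.smul_apply, Complex.real_smul]
    have hup := re_trace_mul_le_of_le hσ h1
    have hlo := re_trace_mul_le_of_le hσ h2
    rw [halg, Matrix.mul_smul, Matrix.mul_one, Matrix.trace_smul, smul_eq_mul, Complex.re_ofReal_mul, htr,
      Complex.one_re, mul_one] at hup
    rw [halg, Matrix.mul_neg, Matrix.trace_neg, Complex.neg_re, Matrix.mul_smul, Matrix.mul_one, Matrix.trace_smul,
      smul_eq_mul, Complex.re_ofReal_mul, htr, Complex.one_re, mul_one] at hlo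
    exact abs_le.2 ⟨by linarith, hup⟩

/-! ### §2. The eventual per-volume bound on the canonical pressure -/

section Torus

/-- (Local.) As in `TorusMarkovPressureBound.lean`: at the torus, orbital equality is decided through the
linear order (the instance the generic Jordan–Wigner / Gibbs lemmas carry). [folklore] -/
local instance (priority := high) instDecidableEqOrbFermionTorusMarkovTL (L : ℕ) :
    DecidableEq (Orb (FermionTorus 2 L)) :=
  LinearOrder.toDecidableEq

/-- `rectN n L` is within `2` of `n L²`. [folklore] -/
private theorem abs_rectN_sub_le {n : ℝ} (hn0 : 0 ≤ n) (L : ℕ) :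
    |((rectN n L : ℕ) : ℝ) - n * (L : ℝ) ^ 2| ≤ 2 := by
  have hx : 0 ≤ n * (L : ℝ) ^ 2 / 2 := by positivity
  have h1 := Nat.floor_le hx
  have h2 := Nat.lt_floor_add_one (n * (L : ℝ) ^ 2 / 2)
  rw [rectN, Nat.cast_mul, Nat.cast_two, abs_le]
  constructor <;> nlinarith

/-- **Eventual per-volume bound on the canonical pressure from a Markov certificate.** Fix the `t–t'`
Hubbard couplings, a density `n ∈ [0,2]`, `β_h` and `μ` real, a window `Λ ⊆ [0,ℓ_w)²` with lexicographically
largest site `a` containing `z + [-1,1]²` and `x`, a Hermitian `G ∈ 𝔄_Λ` with zero expectation in the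
window marginal of the grand-canonical Gibbs density for every torus side `L ≥ 3, ℓ_w`, and a dual
`(L_B, c)` passing the certificate for `h = β_h (Γ(τ_z E_Φ) − μ(n_{x↑}+n_{x↓}) + G)`. Then for every
`ε > 0`, eventually along `Ls → ∞`:
`log Z_{β_h}(sectorHamiltonianTT' t t' U n (Ls j)) ≤ (c − β_h μ n + ε) (Ls j)²`.
[cite: PoulinHastings2011, eqs. (3)–(8)] [cite: Ruelle1969, §3.4] -/
theorem eventually_log_partitionFn_sectorHamiltonianTT'_le_of_certificate (t t' U μ βh : ℝ) {n : ℝ}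
    (hn0 : 0 ≤ n) (hn2 : n ≤ 2) {Ls : ℕ → ℕ} (hLs : Tendsto Ls atTop atTop)
    {Λ : Finset (Site 2)} {a : Site 2} (ha : a ∈ Λ) (hmax : ∀ y ∈ Λ, toLex y ≤ toLex a)
    {ℓw : ℕ} (hΛ : Λ ⊆ halfOpenBox 2 ℓw)
    {z : Site 2} (hz : shiftSet z (thicken ({0} : Finset (Site 2)) 1) ⊆ Λ) {x : Site 2} (hx : x ∈ Λ)
    {G : FermionOp Λ} (hG : G.IsHermitian)
    (hG0 : ∀ (L : ℕ) [NeZero L], 3 ≤ L → ∀ hℓL : ℓw ≤ L,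
      (fermionPartialTrace (PolySite.toTorusEmb L (injOn_proj_of_subset_halfOpenBox' hΛ hℓL))
        ((partitionFn βh (hubbardTorusTT' L t t' U - (μ : ℂ) • totalNumber))⁻¹ •
          gibbsWeight βh (hubbardTorusTT' L t t' U - (μ : ℂ) • totalNumber)) * G).trace = 0)
    {LB : FermionOp (Λ.erase a)} (hLB : LB.IsHermitian) {c : ℝ}
    (hcert : ((Real.exp c : ℂ) • cfc Real.exp LB -
      fermionPartialTrace (PolySite.incl (Finset.erase_subset a Λ))
        (cfc Real.exp (-((βh : ℂ) •
            (fermionEmbed (PolySite.incl hz) (fermionEmbed (PolySite.shiftEmb z (thicken ({0} : Finset (Site 2)) 1))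
                ((hubbardTTPrimeFermionInteraction t t' U).meanEnergyObs 1))
              - (μ : ℂ) • (nAt x hx 0 + nAt x hx 1) + G)) +
          fermionEmbed (PolySite.incl (Finset.erase_subset a Λ)) LB))).PosSemidef)
    {ε : ℝ} (hε : 0 < ε) :
    ∀ᶠ j in atTop, Real.log (partitionFn βh (sectorHamiltonianTT' t t' U n (Ls j))).re ≤
      (c - βh * μ * n + ε) * (Ls j : ℝ) ^ 2 := by
  -- the window energy observable and its uniform bound
  set hW : FermionOp Λ := fermionEmbed (PolySite.incl hz)
      (fermionEmbed (PolySite.shiftEmb z (thicken ({0} : Finset (Site 2)) 1))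
        ((hubbardTTPrimeFermionInteraction t t' U).meanEnergyObs 1))
      - (μ : ℂ) • (nAt x hx 0 + nAt x hx 1) + G with hWdef
  have hWherm : hW.IsHermitian := by
    rw [hWdef]
    refine Matrix.IsHermitian.add (Matrix.IsHermitian.sub ?_ ?_) hG
    · have hEherm : ((hubbardTTPrimeFermionInteraction t t' U).meanEnergyObs 1).IsHermitian := by
        unfold FermionInteraction.meanEnergyObs Matrix.IsHermitian
        rw [Matrix.conjTranspose_sum]
        refine Finset.sum_congr rfl fun X _ => ?_
        rw [Matrix.conjTranspose_smul, ← fermionEmbed_conjTranspose,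
          ((hubbardTTPrimeFermionInteraction_isHermitian t t' U) X.1).eq]
        congr 1
        rw [Complex.star_def, map_inv₀, map_natCast]
      change (fermionEmbed _ (fermionEmbed _ _))ᴴ = _
      rw [← fermionEmbed_conjTranspose, ← fermionEmbed_conjTranspose, hEherm.eq]
    · change ((μ : ℂ) • (nAt x hx 0 + nAt x hx 1))ᴴ = _
      have hn : ∀ σ : Fin 2, (nAt x hx σ : FermionOp Λ)ᴴ = nAt x hx σ := fun σ => by
        change (creation _ * annihilation _)ᴴ = creation _ * annihilation _
        rw [Matrix.conjTranspose_mul, creation, Matrix.conjTranspose_conjTranspose]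
      rw [Matrix.conjTranspose_smul, Complex.star_def, Complex.conj_ofReal, Matrix.conjTranspose_add, hn, hn]
  obtain ⟨E, hE⟩ := exists_abs_re_trace_mul_density_le hWherm
  -- the constant of the `O(L)` boundary term
  set C : ℝ := 2 * (ℓw : ℝ) * (Real.log 4 + |c| + |βh| * |E|) + 2 * |βh * μ| with hC
  have hC0 : 0 ≤ 2 * (ℓw : ℝ) * (Real.log 4 + |c| + |βh| * |E|) := by
    have : 0 ≤ Real.log 4 := Real.log_nonneg (by norm_num)
    positivity
  -- eventually `C · L + … ≤ ε L²`
  have hev : ∀ᶠ j in atTop, 3 ≤ Ls j ∧ ℓw ≤ Ls j ∧ C * (Ls j : ℝ) + 2 * |βh * μ| ≤ ε * (Ls j : ℝ) ^ 2 := by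
    have h1 := hLs.eventually_ge_atTop (max 3 ℓw)
    have h2 : Tendsto (fun j => (Ls j : ℝ)) atTop atTop :=
      tendsto_natCast_atTop_atTop.comp hLs
    have h3 := h2.eventually_ge_atTop ((C + 2 * |βh * μ|) / ε + 1)
    filter_upwards [h1, h3] with j hj hj'
    refine ⟨le_of_max_le_left hj, le_of_max_le_right hj, ?_⟩
    have hL1 : (1 : ℝ) ≤ (Ls j : ℝ) := by
      have : (3 : ℝ) ≤ (Ls j : ℝ) := by exact_mod_cast le_of_max_le_left hj
      linarith
    have hCε : C + 2 * |βh * μ| ≤ ε * (Ls j : ℝ) := by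
      have := (div_le_iff₀ hε).1 (by linarith : (C + 2 * |βh * μ|) / ε ≤ (Ls j : ℝ))
      linarith [this]
    have hab : 0 ≤ 2 * |βh * μ| := by positivity
    nlinarith [hCε, hL1, hab, hC0]
  filter_upwards [hev] with j ⟨hj3, hjw, hjε⟩
  haveI : NeZero (Ls j) := ⟨by omega⟩
  -- the finite-volume Markov bound at side `Ls j` (the torus files carry the order-derived `DecidableEq`
  -- instances at the torus; ours are the structural ones — `convert` bridges the (subsingleton) gap)
  have hM0 := hubbardTTPrime_log_partitionFn_le_of_certificate (Ls j) t t' U μ βh hj3 ha hmax hΛ hjw hz hx hG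
    (hG0 (Ls j) hj3 hjw) hLB hcert
  -- the grand-canonical comparison (stated in `SectorPartitionFnGrandCanonicalBound.lean` with the structural
  -- `DecidableEq` instance on the grand-canonical side; `convert` bridges the subsingleton gap)
  have hGC0 := log_partitionFn_sectorHamiltonianTT'_le_grandCanonical t t' U hn0 hn2 (Ls j) βh μ
  have hGC : Real.log (partitionFn βh (sectorHamiltonianTT' t t' U n (Ls j))).re ≤
      Real.log (partitionFn βh (hubbardTorusTT' (Ls j) t t' U - (μ : ℂ) • totalNumber)).re -
        βh * μ * ((rectN n (Ls j) : ℕ) : ℝ) := by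
    convert hGC0
  -- bookkeeping
  set Lr : ℝ := (Ls j : ℝ) with hLr
  set e : ℝ := (fermionPartialTrace (PolySite.toTorusEmb (Ls j) (injOn_proj_of_subset_halfOpenBox' hΛ hjw))
      ((partitionFn βh (hubbardTorusTT' (Ls j) t t' U - (μ : ℂ) • totalNumber))⁻¹ •
        gibbsWeight βh (hubbardTorusTT' (Ls j) t t' U - (μ : ℂ) • totalNumber)) * hW).trace.re with hedef
  have heE : |e| ≤ E := by
    rw [hedef]
    haveI : Nonempty (Finset (Orb (FermionTorus 2 (Ls j)))) := ⟨∅⟩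
    have hK : (hubbardTorusTT' (Ls j) t t' U - (μ : ℂ) • totalNumber).IsHermitian := by
      refine (hubbardTorusTT'_isHermitian (Ls j) t t' U).sub ?_
      change ((μ : ℂ) • totalNumber)ᴴ = (μ : ℂ) • totalNumber
      have hN : (totalNumber : Matrix (Finset (Orb (FermionTorus 2 (Ls j)))) (Finset (Orb (FermionTorus 2 (Ls j)))) ℂ)ᴴ =
          totalNumber := by
        rw [totalNumber_eq_diagonal_card, Matrix.diagonal_conjTranspose]
        congr 1
        funext s
        simp
      rw [Matrix.conjTranspose_smul, Complex.star_def, Complex.conj_ofReal, hN]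
    refine hE _ (posSemidef_fermionPartialTrace _ (hK.posSemidef_gibbsDensity βh)) ?_
    rw [trace_fermionPartialTrace, trace_gibbsDensity _ _ (partitionFn_pos βh hK).ne']
  -- `L² − (L+1−ℓw)² ≤ 2 ℓw L`
  have hN1 : (((Ls j) ^ 2 : ℕ) : ℝ) - ((((Ls j) + 1 - ℓw) ^ 2 : ℕ) : ℝ) ≤ 2 * (ℓw : ℝ) * Lr := by
    have hsub : (((Ls j) + 1 - ℓw : ℕ) : ℝ) = Lr + 1 - (ℓw : ℝ) := by
      rw [Nat.cast_sub (by omega)]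
      push_cast
      rw [hLr]
    push_cast
    rw [hsub]
    nlinarith [sq_nonneg ((ℓw : ℝ) - 1), show (0 : ℝ) ≤ ℓw from Nat.cast_nonneg ℓw]
  have hN0 : 0 ≤ (((Ls j) ^ 2 : ℕ) : ℝ) - ((((Ls j) + 1 - ℓw) ^ 2 : ℕ) : ℝ) := by
    have : ((Ls j) + 1 - ℓw) ^ 2 ≤ (Ls j) ^ 2 := by
      rcases Nat.eq_zero_or_pos ℓw with hℓ | hℓ
      · exfalso
        have := mem_halfOpenBox.1 (hΛ ha) 0
        omega
      · exact Nat.pow_le_pow_left (by omega) 2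
    have h' : ((((Ls j) + 1 - ℓw) ^ 2 : ℕ) : ℝ) ≤ (((Ls j) ^ 2 : ℕ) : ℝ) := by exact_mod_cast this
    linarith
  -- the factor `log 4 − c − βh e` is bounded
  have hfac : Real.log 4 - c - βh * e ≤ Real.log 4 + |c| + |βh| * |E| := by
    have h1 : -c ≤ |c| := neg_le_abs c
    have h2 : -(βh * e) ≤ |βh| * |E| := by
      calc -(βh * e) ≤ |βh * e| := neg_le_abs _
        _ = |βh| * |e| := abs_mul _ _
        _ ≤ |βh| * |E| := mul_le_mul_of_nonneg_left (heE.trans (le_abs_self E)) (abs_nonneg _)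
    linarith
  have hbd : ((((Ls j) ^ 2 : ℕ) : ℝ) - ((((Ls j) + 1 - ℓw) ^ 2 : ℕ) : ℝ)) * (Real.log 4 - c - βh * e) ≤
      2 * (ℓw : ℝ) * (Real.log 4 + |c| + |βh| * |E|) * Lr := by
    calc ((((Ls j) ^ 2 : ℕ) : ℝ) - ((((Ls j) + 1 - ℓw) ^ 2 : ℕ) : ℝ)) * (Real.log 4 - c - βh * e)
        ≤ ((((Ls j) ^ 2 : ℕ) : ℝ) - ((((Ls j) + 1 - ℓw) ^ 2 : ℕ) : ℝ)) * (Real.log 4 + |c| + |βh| * |E|) :=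
          mul_le_mul_of_nonneg_left hfac hN0
      _ ≤ 2 * (ℓw : ℝ) * Lr * (Real.log 4 + |c| + |βh| * |E|) :=
          mul_le_mul_of_nonneg_right hN1 (by
            have : 0 ≤ Real.log 4 := Real.log_nonneg (by norm_num)
            positivity)
      _ = 2 * (ℓw : ℝ) * (Real.log 4 + |c| + |βh| * |E|) * Lr := by ring
  -- the particle-number term
  have hμ : -(βh * μ * ((rectN n (Ls j) : ℕ) : ℝ)) ≤ -(βh * μ * n) * Lr ^ 2 + 2 * |βh * μ| := by
    have hr := abs_rectN_sub_le hn0 (Ls j)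
    have : |βh * μ * (((rectN n (Ls j) : ℕ) : ℝ) - n * Lr ^ 2)| ≤ |βh * μ| * 2 := by
      rw [abs_mul]
      exact mul_le_mul_of_nonneg_left hr (abs_nonneg _)
    have h' := (abs_le.1 this).1
    nlinarith [h']
  -- assemble
  have hM' : Real.log (partitionFn βh (hubbardTorusTT' (Ls j) t t' U - (μ : ℂ) • totalNumber)).re ≤
      ((Ls j : ℝ) ^ 2) * c +
        ((((Ls j) ^ 2 : ℕ) : ℝ) - ((((Ls j) + 1 - ℓw) ^ 2 : ℕ) : ℝ)) * (Real.log 4 - c - βh * e) := by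
    rw [hedef]
    exact hM0
  have hCL : C * Lr + 2 * |βh * μ| ≤ ε * Lr ^ 2 := hjε
  rw [hC] at hCL
  rw [← hLr] at hM'
  have hpos : 0 ≤ 2 * |βh * μ| * Lr := by positivity
  linarith [hM', hGC, hbd, hμ, hCL, hpos]

/-! ### §3. The certified upper edge of the thermal energy window -/

namespace InfVolFermionState

variable {t t' U n β : ℝ} {ω : InfVolFermionState 2} {Ls : ℕ → ℕ}

/-- **The hot chord with a Markov certificate: a certified upper edge of the thermal energy window.**
For every torus limit `ω` of the canonical sector Gibbs states of the `t–t'` Hubbard model at density `n`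
and inverse temperature `β` along `Ls → ∞`, a cold input `ℓ (Ls j)² ≤ log Z_β^{sector}(Ls j)` (eventually),
and a Markov certificate `(Λ, a, z, x, G, L_B, c)` at `0 < β_h < β` and chemical potential `μ` as in
`eventually_log_partitionFn_sectorHamiltonianTT'_le_of_certificate`:
`e_Φ(ω) ≤ (c − β_h μ n − ℓ) / (β − β_h)`. [cite: PoulinHastings2011, eqs. (3)–(8)]
[cite: GustafsonSigal2003, §18.3 Theorem 18.10] -/
theorem IsTorusLimitOfMixture.meanEnergy_hubbardTTPrime_le_of_markov_certificate
    (hn0 : 0 ≤ n) (hn2 : n ≤ 2)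
    (h : ω.IsTorusLimitOfMixture (sectorGibbsCount n) (fun L => sectorGibbsWeightTT' β t t' U n L)
      (fun L => sectorGibbsVectorTT' t t' U n L) Ls)
    (hLs : Tendsto Ls atTop atTop) {βh ℓ : ℝ} (hβh : 0 < βh) (hlt : βh < β)
    (hℓ : ∀ᶠ j in atTop, ℓ * (Ls j : ℝ) ^ 2 ≤
      Real.log (partitionFn β (sectorHamiltonianTT' t t' U n (Ls j))).re)
    (μ : ℝ) {Λ : Finset (Site 2)} {a : Site 2} (ha : a ∈ Λ) (hmax : ∀ y ∈ Λ, toLex y ≤ toLex a)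
    {ℓw : ℕ} (hΛ : Λ ⊆ halfOpenBox 2 ℓw)
    {z : Site 2} (hz : shiftSet z (thicken ({0} : Finset (Site 2)) 1) ⊆ Λ) {x : Site 2} (hx : x ∈ Λ)
    {G : FermionOp Λ} (hG : G.IsHermitian)
    (hG0 : ∀ (L : ℕ) [NeZero L], 3 ≤ L → ∀ hℓL : ℓw ≤ L,
      (fermionPartialTrace (PolySite.toTorusEmb L (injOn_proj_of_subset_halfOpenBox' hΛ hℓL))
        ((partitionFn βh (hubbardTorusTT' L t t' U - (μ : ℂ) • totalNumber))⁻¹ •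
          gibbsWeight βh (hubbardTorusTT' L t t' U - (μ : ℂ) • totalNumber)) * G).trace = 0)
    {LB : FermionOp (Λ.erase a)} (hLB : LB.IsHermitian) {c : ℝ}
    (hcert : ((Real.exp c : ℂ) • cfc Real.exp LB -
      fermionPartialTrace (PolySite.incl (Finset.erase_subset a Λ))
        (cfc Real.exp (-((βh : ℂ) •
            (fermionEmbed (PolySite.incl hz) (fermionEmbed (PolySite.shiftEmb z (thicken ({0} : Finset (Site 2)) 1))
                ((hubbardTTPrimeFermionInteraction t t' U).meanEnergyObs 1))
              - (μ : ℂ) • (nAt x hx 0 + nAt x hx 1) + G)) +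
          fermionEmbed (PolySite.incl (Finset.erase_subset a Λ)) LB))).PosSemidef) :
    ω.meanEnergy (hubbardTTPrimeFermionInteraction t t' U) 1 ≤ (c - βh * μ * n - ℓ) / (β - βh) := by
  have hβ : 0 < β - βh := sub_pos.2 hlt
  refine le_of_forall_pos_le_add fun ε hε => ?_
  have hε' : 0 < ε * (β - βh) := mul_pos hε hβ
  have huh := eventually_log_partitionFn_sectorHamiltonianTT'_le_of_certificate t t' U μ βh hn0 hn2 hLs ha hmax
    hΛ hz hx hG hG0 hLB hcert hε'
  have hchord := IsTorusLimitOfMixture.meanEnergy_hubbardTTPrime_le_chord_of_sectorGibbs hn0 hn2 h hLs hβh hlt hℓ huh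
  calc ω.meanEnergy (hubbardTTPrimeFermionInteraction t t' U) 1
      ≤ (c - βh * μ * n + ε * (β - βh) - ℓ) / (β - βh) := hchord
    _ = (c - βh * μ * n - ℓ) / (β - βh) + ε := by field_simp; ring

end InfVolFermionState

end Torus

end Literature.MathematicalPhysics.QuantumLattice

end
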